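import Summits.QuantumFields.QCD.Theorems.QuarksAsStableActionCriticalLineDiamagnetismRectDiamagnetism
import Summits.QuantumFields.QCD.Theorems.QuarksAsStableActionCriticalLineDiamagnetismRectFreqOpStatic
import Summits.QuantumFields.QCD.Theorems.QuarksAsStableActionCriticalLineDiamagnetismRectFreqOpTransfer
import Summits.QuantumFields.QCD.Theorems.QuarksAsStableActionCriticalLineDiamagnetismPressure

/-!
# Route B helper `staticPressureOdd` for stub `stub_heavyFrequencyGain` of line `Sketch` — on an ODD slice space the
static pressure of any row is at most the free one
(crux `Summit.QuantumFields.QCD.Theses.QuarksAsStableAction.CriticalLineDiamagnetism`, item stmt-QuantumFields-9734,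
static route for odd tori, Route B of the heavy-frequency gain)

For `L₂` odd, a row of links `r : ℤ/L₂ → U(3)` along the second coordinate, `m > −1` and a real frequency pair, let
`e_r = ‖det (A_r P⁻ − P⁺)‖` and `M_r` be the `E`-factor and Lüscher's dressed one-step matrix of the row (the slice data
`sliceOpR`, `oneStepR` of the field on `ℤ/1 × ℤ/L₂` with links `r` along the second coordinate and trivial links along the
first), and `p(M) = Σᵢ log max(μᵢ(M), 1)` the pressure.  Then `log e_r + p(M_r) ≤ log e_1 + p(M_1)` (`staticPressureOdd`,
registered).

Proof.  For every odd time length `L₁` the field `S` on `ℤ/L₁ × ℤ/L₂` with links `r` along the second coordinate on every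
row (and trivial links along the first) is dominated by the free field (`rectDiamagnetism`, odd × odd); both determinants
are in normal form `‖det D[S]‖ = e^{L₁} · Re det(1 + M^{L₁})` (`rectNormDetStatic`, `det_tfreqOpR`), where the slice data of
`S` at row `0` ARE the slice data of the one-row field (`sliceOpR_congr`, `oneStepR_congr`: they only read the links of the
row).  Taking logarithms (`e > 0` by `isUnit_det_projChainBlock`, `Re det(1 + M^{L₁}) = ∏ (1 + μᵢ^{L₁}) > 0` by
`det_one_add_pow_eq`), dividing by `L₁` and letting `L₁ → ∞` along the odd numbers with the uniform rate of
`pressureLimit` gives the claim.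
-/

noncomputable section

open scoped BigOperators Matrix ComplexConjugate ComplexOrder
open Finset
open Literature.MathematicalPhysics.QuantumLattice Literature.MathematicalPhysics.QuantumFieldTheory
  Literature.Probability.LatticeModels

namespace Summit.QuantumFields.QCD.Cruxes.CriticalLineDiamagnetism.ChessboardCellGain

namespace FrequencyDiamagnetism

open Matrix Complex
open Summit.QuantumFields.QCD.Cruxes.StableActionBridge.Sketch

/-! ### The `E`-factor is invertible -/

/-- The `E`-factor `A_t P⁻ − P⁺` of a row is invertible for `m > −1` (the chain-block lemma with trivial transporter). -/
theorem norm_det_sliceE_pos {L₁ L₂ : ℕ} [NeZero L₁] [NeZero L₂] (A : ZMod L₁ → ZMod L₂ → Fin 4 → Matrix.unitaryGroup (Fin 3) ℂ)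
    {m : ℝ} (hm : -1 < m) (ω₀ ω₁ : ℝ) (t : ZMod L₁) : 0 < ‖(sliceOpR A m ω₀ ω₁ t * projM L₂ - projP L₂).det‖ := by
  have hP : projP L₂ + projM L₂ = 1 := liftProjPlus_add_liftProjMinus (ZMod L₂) 3
  have hPQ : projP L₂ * projM L₂ = 0 := liftProjPlus_mul_liftProjMinus (ZMod L₂) 3
  have hQP : projM L₂ * projP L₂ = 0 := liftProjMinus_mul_liftProjPlus (ZMod L₂) 3
  obtain ⟨hPAP, hBP, -⟩ := slice_spin_structureR A m ω₀ ω₁ t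
  have h := isUnit_det_projChainBlock (ZMod L₂ × Fin 3 × Fin 4) (sliceOpR A m ω₀ ω₁ t) (sliceBhR A m ω₀ ω₁ t) 1
    (projP L₂) (projM L₂) hP hPQ hQP hPAP hBP (isUnit_det_sliceBhR A hm ω₀ ω₁ t) (by rw [Matrix.one_mul, Matrix.mul_one])
    (by rw [Matrix.det_one]; exact isUnit_one)
  rw [Matrix.mul_one] at h
  exact norm_pos_iff.mpr h.ne_zero

/-! ### The normal form of a row-static determinant in terms of the one-row slice data -/

/-- For a field `B` on `ℤ/L₁ × ℤ/L₂` with trivial links along the first coordinate and the links of the one-row field `A₁`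
along the second coordinate on every row, `‖det D[B]‖ = e^{L₁} · Re det(1 + M^{L₁})` with `(e, M)` the slice data of `A₁`. -/
theorem norm_det_freqOpR_rowStatic {L₁ L₂ : ℕ} [NeZero L₁] [NeZero L₂]
    (A₁ : ZMod 1 → ZMod L₂ → Fin 4 → Matrix.unitaryGroup (Fin 3) ℂ)
    (B : ZMod L₁ → ZMod L₂ → Fin 4 → Matrix.unitaryGroup (Fin 3) ℂ)
    (h2 : ∀ t x, B t x 2 = 1) (h3 : ∀ t x, B t x 3 = A₁ 0 x 3) {m : ℝ} (hm : -1 < m) (ω₀ ω₁ : ℝ) :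
    ‖(freqOpR euclideanGamma B m ω₀ ω₁).det‖ =
      ‖(sliceOpR A₁ m ω₀ ω₁ 0 * projM L₂ - projP L₂).det‖ ^ L₁ * ((1 + oneStepR A₁ m ω₀ ω₁ 0 ^ L₁).det).re := by
  have hstat : freqOpR euclideanGamma B m ω₀ ω₁ =
      freqOpR euclideanGamma (fun (_ : ZMod L₁) (x : ZMod L₂) (μ : Fin 4) => if μ = 3 then B 0 x 3 else 1) m ω₀ ω₁ :=
    freqOpR_congr_links (fun (_ : ZMod L₁) (x : ZMod L₂) (μ : Fin 4) => if μ = 3 then B 0 x 3 else 1) m ω₀ ω₁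
      euclideanGamma B (fun t x => by rw [if_neg (by decide), h2]) (fun t x => by rw [if_pos rfl, h3, h3])
  rw [hstat, ← det_tfreqOpR, rectNormDetStatic B hm ω₀ ω₁ 0,
    sliceOpR_congr A₁ B m ω₀ ω₁ (0 : ZMod L₁) (0 : ZMod 1) (fun x => h3 0 x),
    oneStepR_congr A₁ B m ω₀ ω₁ (0 : ZMod L₁) (0 : ZMod 1) (fun x => h3 0 x)]

/-- The level-`L₁` comparison (`L₁`, `L₂` odd): `e_r^{L₁} · Re det(1 + M_r^{L₁}) ≤ e_1^{L₁} · Re det(1 + M_1^{L₁})`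
(`rectDiamagnetism` for the row-static field of time length `L₁`, in normal form). -/
theorem rowStatic_level_le {L₁ L₂ : ℕ} [NeZero L₁] [NeZero L₂] (hL₁ : Odd L₁) (hL₂ : Odd L₂)
    (r : ZMod L₂ → Matrix.unitaryGroup (Fin 3) ℂ) {m : ℝ} (hm : -1 < m) (ω₀ ω₁ : ℝ) :
    ‖(sliceOpR (fun (_ : ZMod 1) (x : ZMod L₂) (μ : Fin 4) => if μ = 3 then r x else 1) m ω₀ ω₁ 0 * projM L₂ -
          projP L₂).det‖ ^ L₁ *
        ((1 + oneStepR (fun (_ : ZMod 1) (x : ZMod L₂) (μ : Fin 4) => if μ = 3 then r x else 1) m ω₀ ω₁ 0 ^ L₁).det).re ≤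
      ‖(sliceOpR (fun (_ : ZMod 1) (_ : ZMod L₂) (_ : Fin 4) => (1 : Matrix.unitaryGroup (Fin 3) ℂ)) m ω₀ ω₁ 0 * projM L₂ -
          projP L₂).det‖ ^ L₁ *
        ((1 + oneStepR (fun (_ : ZMod 1) (_ : ZMod L₂) (_ : Fin 4) => (1 : Matrix.unitaryGroup (Fin 3) ℂ)) m ω₀ ω₁ 0 ^
          L₁).det).re := by
  rw [← norm_det_freqOpR_rowStatic (fun (_ : ZMod 1) (x : ZMod L₂) (μ : Fin 4) => if μ = 3 then r x else 1)
      (fun (_ : ZMod L₁) (x : ZMod L₂) (μ : Fin 4) => if μ = 3 then r x else 1) (fun _ _ => if_neg (by decide))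
      (fun _ _ => rfl) hm ω₀ ω₁,
    ← norm_det_freqOpR_rowStatic (fun (_ : ZMod 1) (_ : ZMod L₂) (_ : Fin 4) => (1 : Matrix.unitaryGroup (Fin 3) ℂ))
      (fun (_ : ZMod L₁) (_ : ZMod L₂) (_ : Fin 4) => (1 : Matrix.unitaryGroup (Fin 3) ℂ)) (fun _ _ => rfl)
      (fun _ _ => rfl) hm ω₀ ω₁]
  exact rectDiamagnetism L₁ L₂ hL₁ hL₂ _ m hm ω₀ ω₁

end FrequencyDiamagnetism

/-! ### The limit along odd time lengths -/

/-- `Re det(1 + M^N) = ∏ᵢ (1 + μᵢ^N) > 0` for `M ⪰ 0`. -/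
theorem re_det_one_add_pow_pos {k : Type} [Fintype k] [DecidableEq k] {M : Matrix k k ℂ} (hM : M.PosSemidef) (N : ℕ) :
    0 < ((1 + M ^ N).det).re := by
  rw [det_one_add_pow_eq M hM N, ← Complex.ofReal_prod, Complex.ofReal_re]
  exact Finset.prod_pos fun i _ =>
    lt_of_lt_of_le zero_lt_one (le_add_of_nonneg_right (pow_nonneg (hM.eigenvalues_nonneg i) N))

/-- **Pressures from the levels.**  If `e_r^N · Re det(1 + M_r^N) ≤ e_1^N · Re det(1 + M_1^N)` at every odd level `N`
(`e_r, e_1 > 0`, `M_r, M_1 ⪰ 0`), then `log e_r + p(M_r) ≤ log e_1 + p(M_1)`: take logarithms, divide by `N` and let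
`N → ∞` with the uniform rate `|log Re det(1 + M^N)/N − p(M)| ≤ #k·log 2/N` of `pressureLimit`. -/
theorem pressure_le_of_levels {k : Type} [Fintype k] [DecidableEq k] {Mr M1 : Matrix k k ℂ}
    (hr : Mr.PosSemidef) (h1 : M1.PosSemidef) {er e1 : ℝ} (her : 0 < er) (he1 : 0 < e1)
    (h : ∀ n : ℕ, er ^ (2 * n + 1) * ((1 + Mr ^ (2 * n + 1)).det).re ≤
      e1 ^ (2 * n + 1) * ((1 + M1 ^ (2 * n + 1)).det).re) :
    Real.log er + ∑ i, Real.log (max (hr.1.eigenvalues i) 1) ≤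
      Real.log e1 + ∑ i, Real.log (max (h1.1.eigenvalues i) 1) := by
  have hc0 : 0 ≤ (Fintype.card k : ℝ) * Real.log 2 := mul_nonneg (Nat.cast_nonneg _) (Real.log_nonneg one_le_two)
  -- the bound at every odd level `N = 2n + 1`
  have hlevel : ∀ n : ℕ, Real.log er + ∑ i, Real.log (max (hr.1.eigenvalues i) 1) ≤
      Real.log e1 + ∑ i, Real.log (max (h1.1.eigenvalues i) 1) +
        2 * ((Fintype.card k : ℝ) * Real.log 2) / ((2 * n + 1 : ℕ) : ℝ) := fun n => by
    have hN : 0 < 2 * n + 1 := Nat.succ_pos _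
    have hNr : (0 : ℝ) < ((2 * n + 1 : ℕ) : ℝ) := by exact_mod_cast hN
    have hdr := re_det_one_add_pow_pos hr (2 * n + 1)
    have hd1 := re_det_one_add_pow_pos h1 (2 * n + 1)
    have hpr := (abs_le.mp (pressureLimit Mr hr (2 * n + 1) hN)).1
    have hp1 := (abs_le.mp (pressureLimit M1 h1 (2 * n + 1) hN)).2
    have hlog : ((2 * n + 1 : ℕ) : ℝ) * Real.log er + Real.log ((1 + Mr ^ (2 * n + 1)).det).re ≤
        ((2 * n + 1 : ℕ) : ℝ) * Real.log e1 + Real.log ((1 + M1 ^ (2 * n + 1)).det).re := by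
      rw [← Real.log_pow, ← Real.log_pow, ← Real.log_mul (pow_pos her _).ne' hdr.ne',
        ← Real.log_mul (pow_pos he1 _).ne' hd1.ne']
      exact Real.log_le_log (mul_pos (pow_pos her _) hdr) (h n)
    have hdiv : Real.log er + Real.log ((1 + Mr ^ (2 * n + 1)).det).re / ((2 * n + 1 : ℕ) : ℝ) ≤
        Real.log e1 + Real.log ((1 + M1 ^ (2 * n + 1)).det).re / ((2 * n + 1 : ℕ) : ℝ) := by
      have h' := div_le_div_of_nonneg_right hlog hNr.le
      rwa [add_div, add_div, mul_div_cancel_left₀ _ hNr.ne', mul_div_cancel_left₀ _ hNr.ne'] at h'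
    have h2c : 2 * ((Fintype.card k : ℝ) * Real.log 2) / ((2 * n + 1 : ℕ) : ℝ) =
        (Fintype.card k : ℝ) * Real.log 2 / ((2 * n + 1 : ℕ) : ℝ) +
          (Fintype.card k : ℝ) * Real.log 2 / ((2 * n + 1 : ℕ) : ℝ) := by
      ring
    linarith
  -- `N → ∞` along the odd numbers
  refine le_of_forall_pos_le_add fun ε hε => ?_
  obtain ⟨n, hn⟩ := exists_nat_gt (2 * ((Fintype.card k : ℝ) * Real.log 2) / ε)
  refine (hlevel n).trans (add_le_add le_rfl ?_)
  have hNr : (0 : ℝ) < ((2 * n + 1 : ℕ) : ℝ) := by exact_mod_cast Nat.succ_pos _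
  rw [div_le_iff₀ hNr]
  rw [div_lt_iff₀ hε] at hn
  have hnN : (n : ℝ) ≤ ((2 * n + 1 : ℕ) : ℝ) := by exact_mod_cast (by omega : n ≤ 2 * n + 1)
  have hmul := mul_le_mul_of_nonneg_right hnN hε.le
  linarith

open FrequencyDiamagnetism in
/-- **Route B helper `staticPressureOdd`** (on an ODD slice space, the static pressure of any row is at most the free one):
for `L₂` odd, a row of links `r : ℤ/L₂ → U(3)`, `m > −1` and a real frequency pair, `log e_r + p(M_r) ≤ log e_1 + p(M_1)`,
where `e = ‖det (A P⁻ − P⁺)‖` and `M` are the `E`-factor and the (positive definite) dressed one-step matrix of the one-row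
field and `p(M) = Σᵢ log max(μᵢ(M), 1)` — the limit of `rectDiamagnetism` in the normal form `rectNormDetStatic` along odd
time lengths, by `pressureLimit`. -/
theorem staticPressureOdd : ∀ (L₂ : ℕ) [NeZero L₂], Odd L₂ → ∀ (r : ZMod L₂ → Matrix.unitaryGroup (Fin 3) ℂ) (m : ℝ), -1 < m → ∀ (ω₀ ω₁ : ℝ) (hr : (oneStepR (fun (_ : ZMod 1) (x : ZMod L₂) (μ : Fin 4) => if μ = 3 then r x else 1) m ω₀ ω₁ 0).PosDef) (h1 : (oneStepR (fun (_ : ZMod 1) (_ : ZMod L₂) (_ : Fin 4) => (1 : Matrix.unitaryGroup (Fin 3) ℂ)) m ω₀ ω₁ 0).PosDef), Real.log ‖(sliceOpR (fun (_ : ZMod 1) (x : ZMod L₂) (μ : Fin 4) => if μ = 3 then r x else 1) m ω₀ ω₁ 0 * projM L₂ - projP L₂).det‖ + ∑ i, Real.log (max (hr.1.eigenvalues i) 1) ≤ Real.log ‖(sliceOpR (fun (_ : ZMod 1) (_ : ZMod L₂) (_ : Fin 4) => (1 : Matrix.unitaryGroup (Fin 3) ℂ)) m ω₀ ω₁ 0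 * projM L₂ - projP L₂).det‖ + ∑ i, Real.log (max (h1.1.eigenvalues i) 1) := by
  intro L₂ _ hL₂ r m hm ω₀ ω₁ hr h1
  exact pressure_le_of_levels hr.posSemidef h1.posSemidef (norm_det_sliceE_pos _ hm ω₀ ω₁ 0)
    (norm_det_sliceE_pos _ hm ω₀ ω₁ 0) fun n => rowStatic_level_le (L₁ := 2 * n + 1) ⟨n, rfl⟩ hL₂ r hm ω₀ ω₁

end Summit.QuantumFields.QCD.Cruxes.CriticalLineDiamagnetism.ChessboardCellGain

end
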